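import Literature.AnabelianGeometry.EtaleTheta.KummerContH1
import Literature.AnabelianGeometry.EtaleTheta.KummerKernel
import HarnessLib

/-!
# The kernel of the continuous Kummer class (coefficients `Λ(A) ≅ A'`): invariant roots, divisibility

Proof-only companion (no definitions) of `KummerContH1.lean` (abc-iut-L2-t12) and `KummerKernel.lean`,
layer L2 of the abc-iut cell (seat abc-iut-w5-d125; sub-DAG `plan/L2/SUBDAG-EtTh-Prop14.md`, route note
for row P14/L09 = GAP-LEDGER G-w4d010-2 residual (P14iii-cl), step (3) «independence of the Kummer class
of the coordinate from constants modulo torsion»).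

[EtTh] (S. Mochizuki, Publ. RIMS **45** (2009)) §1 uses the continuous Kummer classes of FUNCTIONS on the
tempered coverings with coefficients `Λ(Fn) = Ẑ(1) ≅ Δ_Θ` (p. 238 «`Δ_Θ ≅ Ẑ(1)`»; Prop. 1.3 p. 247). The
tree's `KummerKernel.lean` PROVES the kernel statement for the `Λ(A)`-valued discrete class
(`kummerClassOfRootSystem_eq_zero_iff`: `κ(a) = 0 ⇔ a` has a compatible system of `H`-INVARIANT roots —
the abstract form of [AbsTopIII] Def. 1.5 (a)/(b) "Kummer-faithful"). This file transports it to the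
continuous class `CyclotomeCoefficients.kummerContClass` of `KummerContH1.lean` when the coefficient map
`Λ(A) → A'` is BIJECTIVE (the printed situation `Λ(Fn) ≅ Δ_Θ`; `CyclotomeCoefficients` itself only records
a homomorphism), and draws the divisibility consequence used to separate functions from constants:

* `kummerContClass_eq_one_of_isInvariant` — an `H`-invariant root system has trivial continuous Kummer
  class (no hypothesis on the coefficients);
* `exists_isInvariant_of_kummerContClass_eq_one` — conversely, if `Λ(A) → A'` is bijective and
  `κ(x) = 1` in `ContH1 φ A' H`, then `a` has an `H`-invariant compatible root system (the coboundary
  `h ↦ φ(h) α φ(h)⁻¹ α⁻¹`, `α = c(ζ)`, twists `x` by `ζ`);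
* `kummerContClass_eq_one_iff` — the kernel statement, for `G`-groups all of whose points have open
  stabilisers (discrete `G`-modules, e.g. `ThetaKummerInput.Fn`);
* `exists_pow_eq_of_kummerContClass_eq_one` — hence `a` is an `N`-th power of an `H`-invariant element for
  EVERY `N ≥ 1`;
* `map_eq_one_of_kummerContClass_eq_one` (via a private divisibility lemma) — so every homomorphism
  `ord : A →* Multiplicative ℤ` (an order-of-vanishing / valuation) kills `a`: an integer divisible by
  every `N ≥ 1` is `0`. (In [EtTh] §1: a function with trivial Kummer class has order `0` at every cusp,
  so the coordinate `Ü` — order `±1` at the cusps, p. 247 — has non-torsion Kummer class modulo constants.)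

Classical ([cite: NeukirchSchmidtWingberg2008, I §5]; [cite: LANA2026Report, §6.1 p.31]); nothing here is
specific to the disputed parts of the IUT corpus; no statement of [EtTh] is asserted.
-/

namespace Literature.AnabelianGeometry.EtaleTheta

namespace CyclotomeCoefficients

variable {G G' : Type} [Group G] [TopologicalSpace G] [SeparatelyContinuousMul G]
  [Group G'] [TopologicalSpace G'] [IsTopologicalGroup G']
  {φ : G →* G'} {A' : Subgroup G'} [A'.Normal] [IsMulCommutative A']
  {A : Type} [CommGroup A] [MulDistribMulAction G A] [TopologicalSpace A]
  (c : CyclotomeCoefficients φ A' A) (H : Subgroup G) {a : A}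

/-- An `H`-INVARIANT compatible root system has trivial continuous Kummer class (its cocycle is
identically `1`). [cite: LANA2026Report, §6.1 p.31] -/
theorem kummerContClass_eq_one_of_isInvariant (x : RootSystem a) (hinv : x.IsInvariant H)
    (ha : a ∈ MulAction.fixedPoints H A)
    (hx : ∀ n : ℕ+, IsOpen (MulAction.stabilizer G (x.root n) : Set G)) :
    c.kummerContClass H x ha hx = 1 := by
  rw [kummerContClass, ← ContH1.mk_one]
  refine ContH1.mk_congr H (funext fun h => ?_) _ _
  change c.hom (x.kummerCocycle ha h) = 1
  rw [x.kummerCocycle_eq_one_of_isInvariant H hinv ha h, map_one]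

/-- If the coefficient map `Λ(A) → A'` is bijective and the continuous Kummer class of `x` is trivial, then
`a` has an `H`-invariant compatible system of roots: a coboundary `h ↦ φ(h) α φ(h)⁻¹ · α⁻¹` with `α = c(ζ)`
reads `c(h • ζ / ζ)`, so `h • x_n / x_n = (h • ζ_n / ζ_n)⁻¹` and `x · ζ` is invariant.
[cite: LANA2026Report, §6.1 p.31] -/
theorem exists_isInvariant_of_kummerContClass_eq_one (hc : Function.Bijective c.hom) (x : RootSystem a)
    (ha : a ∈ MulAction.fixedPoints H A)
    (hx : ∀ n : ℕ+, IsOpen (MulAction.stabilizer G (x.root n) : Set G))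
    (h1 : c.kummerContClass H x ha hx = 1) : ∃ y : RootSystem a, y.IsInvariant H := by
  rw [kummerContClass, ← ContH1.mk_one, ContH1.mk_eq_mk_iff] at h1
  obtain ⟨α, hα⟩ := h1
  obtain ⟨ζ, rfl⟩ := hc.2 α
  refine ⟨x.mulCyclotome ζ⁻¹⁻¹, x.isInvariant_mulCyclotome_inv H ha ζ⁻¹ fun h => ?_⟩
  have hh := hα h
  rw [Pi.one_apply, mul_one] at hh
  -- `hh : (c (κ_x h))⁻¹ = conj(φ h) (c ζ) · (c ζ)⁻¹ = c (h • ζ / ζ)`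
  have hconj : MulAut.conjNormal (φ (h : G)) (c.hom ζ) = c.hom ((h : G) • ζ) := (c.hom_smul h ζ).symm
  rw [hconj, ← map_inv, ← map_inv, ← map_mul, ← div_eq_mul_inv] at hh
  have hinj := hc.1 hh
  -- so `κ_x h = (h • ζ / ζ)⁻¹ = h • ζ⁻¹ / ζ⁻¹`
  rw [smul_inv', inv_div_inv, ← inv_div, ← hinj, inv_inv]

/-- **The kernel of the continuous Kummer class.** For a `G`-group `A` all of whose points have open
stabilisers and a BIJECTIVE coefficient map `Λ(A) → A'`: `κ(a) = 1` in `ContH1 φ A' H` iff `a` admits a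
compatible system of roots all fixed by `H`. [cite: LANA2026Report, §6.1 p.31] -/
theorem kummerContClass_eq_one_iff (hc : Function.Bijective c.hom)
    (hA : ∀ b : A, IsOpen (MulAction.stabilizer G b : Set G)) (x : RootSystem a)
    (ha : a ∈ MulAction.fixedPoints H A) :
    c.kummerContClass H x ha (fun _ => hA _) = 1 ↔ ∃ y : RootSystem a, y.IsInvariant H := by
  refine ⟨c.exists_isInvariant_of_kummerContClass_eq_one H hc x ha _, fun ⟨y, hy⟩ => ?_⟩
  rw [c.kummerContClass_eq H x y ha (fun _ => hA _) (fun _ => hA _)]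
  exact c.kummerContClass_eq_one_of_isInvariant H y hy ha _

/-- An element with an `H`-invariant compatible root system is an `N`-th power of an `H`-fixed element
for every `N ≥ 1`. [cite: LANA2026Report, §6.1 p.31] -/
theorem _root_.Literature.AnabelianGeometry.EtaleTheta.RootSystem.IsInvariant.exists_pow_eq
    {G₀ : Type*} [Group G₀] {A₀ : Type*} [CommGroup A₀] [MulDistribMulAction G₀ A₀] {H₀ : Subgroup G₀}
    {a₀ : A₀} {y : RootSystem a₀} (hy : y.IsInvariant H₀) (N : ℕ+) :
    ∃ b ∈ MulAction.fixedPoints H₀ A₀, b ^ (N : ℕ) = a₀ :=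
  ⟨y.root N, fun h => hy N h, y.pow_self N⟩

/-- If the continuous Kummer class of `a` is trivial (bijective coefficients, open stabilisers), then `a`
is an `N`-th power of an `H`-fixed element for every `N ≥ 1`. [cite: LANA2026Report, §6.1 p.31] -/
theorem exists_pow_eq_of_kummerContClass_eq_one (hc : Function.Bijective c.hom)
    (hA : ∀ b : A, IsOpen (MulAction.stabilizer G b : Set G)) (x : RootSystem a)
    (ha : a ∈ MulAction.fixedPoints H A) (h1 : c.kummerContClass H x ha (fun _ => hA _) = 1) (N : ℕ+) :
    ∃ b ∈ MulAction.fixedPoints H A, b ^ (N : ℕ) = a := by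
  obtain ⟨y, hy⟩ := (c.kummerContClass_eq_one_iff H hc hA x ha).mp h1
  exact hy.exists_pow_eq N

end CyclotomeCoefficients

/-! ### Divisibility: homomorphisms to `ℤ` kill infinitely divisible elements -/

/-- An integer-valued homomorphism (an order of vanishing, a valuation) kills every element that is an
`N`-th power for all `N ≥ 1`: its value is divisible by every `N`, hence `0`. [folklore] -/
private theorem map_eq_one_of_forall_exists_pow_eq {A : Type*} [CommGroup A] (ord : A →* Multiplicative ℤ)
    {a : A} (h : ∀ N : ℕ+, ∃ b : A, b ^ (N : ℕ) = a) : ord a = 1 := by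
  have hdvd : ∀ N : ℕ+, ((N : ℕ) : ℤ) ∣ Multiplicative.toAdd (ord a) := by
    intro N
    obtain ⟨b, rfl⟩ := h N
    exact ⟨Multiplicative.toAdd (ord b), by rw [map_pow, toAdd_pow, nsmul_eq_mul]⟩
  have hz : Multiplicative.toAdd (ord a) = 0 := by
    apply Int.eq_zero_of_dvd_of_natAbs_lt_natAbs
      (hdvd ⟨(Multiplicative.toAdd (ord a)).natAbs + 1, Nat.succ_pos _⟩)
    rw [PNat.mk_coe, Int.natAbs_natCast]
    exact Nat.lt_succ_self _
  exact toAdd_eq_zero.mp hz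

/-- Consequence for Kummer classes: with bijective coefficients and open stabilisers, if the continuous
Kummer class of the `H`-invariant `a` is trivial, then every homomorphism `ord : A →* Multiplicative ℤ`
vanishes on `a`. (Contrapositive, as used for [EtTh] §1's coordinate `Ü`: `ord(Ü) ≠ 0` at a cusp ⇒
`κ(Ü) ≠ 1`; applied to `Ü^k · c`, `c` a constant with `ord(c) = 0`, it gives the non-torsion of `κ(Ü)`
modulo constants.) [cite: LANA2026Report, §6.1 p.31] -/
theorem CyclotomeCoefficients.map_eq_one_of_kummerContClass_eq_one
    {G G' : Type} [Group G] [TopologicalSpace G] [SeparatelyContinuousMul G]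
    [Group G'] [TopologicalSpace G'] [IsTopologicalGroup G']
    {φ : G →* G'} {A' : Subgroup G'} [A'.Normal] [IsMulCommutative A']
    {A : Type} [CommGroup A] [MulDistribMulAction G A] [TopologicalSpace A]
    (c : CyclotomeCoefficients φ A' A) (H : Subgroup G) {a : A} (hc : Function.Bijective c.hom)
    (hA : ∀ b : A, IsOpen (MulAction.stabilizer G b : Set G)) (x : RootSystem a)
    (ha : a ∈ MulAction.fixedPoints H A) (h1 : c.kummerContClass H x ha (fun _ => hA _) = 1)
    (ord : A →* Multiplicative ℤ) : ord a = 1 :=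
  map_eq_one_of_forall_exists_pow_eq ord fun N =>
    let ⟨b, _, hb⟩ := c.exists_pow_eq_of_kummerContClass_eq_one H hc hA x ha h1 N
    ⟨b, hb⟩

end Literature.AnabelianGeometry.EtaleTheta
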